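import Mathlib
import Summits.MatrixMultiplication.MatrixMultiplication.Theses.LevelGradedCohnUmans
import Literature.RepresentationTheory.FiniteGroups.CharacterDegrees
import Literature.RepresentationTheory.FiniteGroups.IrreducibleCharacters
import HarnessLib.Audit
import Summits.MatrixMultiplication.MatrixMultiplication.Theorems.LevelGradedCohnUmansGradedDesignFamilyStubBlockContainment
import Summits.MatrixMultiplication.MatrixMultiplication.Theorems.LevelGradedCohnUmansGradedDesignFamilyStubTangentStructure

/-!
# Line `tangent-cell` — crux `LevelGradedCohnUmans.GradedDesignFamily`
(stmt-MatrixMultiplication-7610, the route TARGET; crux-strategist gen 1, seat s2; an ALTERNATIVE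
line, published with `crux write` + `workitem stub-add`, never touching the live skeleton
`quadratic_extension_level_one_cell`)

THE LINE (transfer lens at crux level: DEGENERATE THE QUADRATIC EXTENSION). The live line hosts
its designs in `GL₂(𝔽_{q²}) ⊃ SL₂(𝔽_q)` and is stuck on the design stub (`stub_subfieldCell`).
Contract the field extension `𝔽_{q²} = 𝔽_q[√d]` to the DUAL NUMBERS `𝔽_q[ε]` (`ε² = 0`, let
`d → 0`): the host becomes the TANGENT GROUP
  `G_q = GL₂(𝔽_q[ε]) = GL₂(𝔽_q) ⋉ M₂(𝔽_q)`   (same order `≈ q⁸`, same `Q := |R| = q²`),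
with the SAME test space — level-one frame functions over the ring `R = 𝔽_q[ε]`,
`g ↦ Σ_{u ∈ R²} c(u, g·u)` — the same wall `D ≈ Q³`, the same `≈ Q` comparable blocks of degree
`≈ Q` (`Irr ∩ J = {1, St, (q−2)×(q+1), (q−1)×(q²−1), (q−1)²×(q²+q)}`, so
`D = 1 + q² + (q−2)(q+1)² + (q−1)(q²−1)² + (q−1)²(q²+q)²`, e.g. `730` at `q = 3`), hence the SAME
universality bookkeeping: level-one separated `X, Y, Z ⊆ GL₂(𝔽_q[ε])` with
`|X|, |Y|, |Z| ≥ c·q³` along `q → ∞` give the crux for every `ε` (`GradedDesignFamily_of`, proved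
below modulo the two registered stubs).  The umbrella crux quantifies over ALL finite groups, so the
ring host is admissible; it is covered by NO sibling crux (`LieRankDesigns`, `LevelOneGL2Designs`
are typed over `ZMod p`) and by no registered line (Lie cells over prime fields, the subfield cell
over fields, colour cells in `𝔖ₙ`, tiling families — dead).

WHAT THE CONTRACTION CHANGES (the lever; all items derived in the strategist's NOTES/census, the
numerical ones machine-checked at `q = 3, 5` with `calc/tshadow*.py`):
* an ABELIAN NORMAL SUBGROUP `N = 1 + εM₂(𝔽_q)` on which level one sees only the DETERMINANTAL
  spectrum: `J|_{N-coset}` = characters `A ↦ ψ(tr βA)` with `rk β ≤ 1` — `q³+q²−q` dimensions for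
  `q⁴` elements (a canonical, provable source of the "blockwise-degenerate garbage" the live lead
  reports as missing in the field cell);
* an explicit FOURIER–MACKEY NORMAL FORM of the whole test space (`L = GL₂(𝔽_q)`):
    `J = F₁(L)·ψ₀ ⊕ ⊕_{rk β = 1} ℂ[L/T_β]·ψ_β`,  `T_β = Stab_L(u₀) ∩ Stab_L(wᵀ)` for `β = u₀wᵀ`
  (a rank-one split torus for `tr β ≠ 0`, a root group for `tr β = 0`), checked against the block
  count (`D = 730` at `q = 3` both ways);
* the `σ = 1` SHADOW of a design with outer piece `X = SL₂(𝔽_q)` lives on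
  `SL₂(𝔽_q)\G_q = 𝔽_q^× × M₂(𝔽_q)` and its matroid is Fourier analysis on `𝔽_q⁴` with spectrum
  the rank-`≤ 1` variety: affine hyperplanes `{tr(γA) = τ}` with `γ` INVERTIBLE are
  HALF-INVISIBLE (rank `q³ − q(q−1)²/2` of `q³+q²−q`; `21/33` at `q = 3`, `85/145` at `q = 5`),
  2-planes are fully visible, rank-one normals are useless — an exact "container menu";
* no Helfgott/sum–product rigidity (the ring has ideals), fractional pieces of every order
  `q^a(q−1)^b` (`U ⋉ W`, `T ⋉ W`, subspaces of `N`), tiny first live exponent-3 cells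
  (`q = 4`: `|G| = 46 080`, `D = 4342`, needs `V > 82 440 = 1.79|G|`; `q = 5`: `|G| = 3·10⁵`).
Honest negatives found with the same tools (card § Dead sub-templates): all shadow garbage inside
ONE invisible hyperplane forces `|Y| ≤ 5` (rank of affine functionals); subgroup triples `(SL₂(𝔽_q)^{(1;P)}, U⋉W₂, U⁻⋉W₃)`
die at `H₁ ∩ H₃H₂`; generic subgroup triples of volume `q⁹` meet in a one-dimensional variety and
need an anisotropy miracle; the depth tower `GL₂(ℤ/p^k)` caps SUBGROUP triples inside `K₁` at
`≈ |G|` (`Ω₁`/layer monotonicity).  The design stub is therefore crux-sized and OPEN, exactly like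
`stub_subfieldCell`, but decided by DIFFERENT mathematics (additive combinatorics / Fourier analysis
on `M₂(𝔽_q)` with determinantal frequencies instead of inversive-plane matroids).

STUBS (registered; statements in tree-only vocabulary):
* T1 `stub_tangentStructure` (M; LANDED p171501, lead c7 — discharged below by the Theorems decl) — the level-one space of `GL₂(K[ε])` is spanned by `≤ 5|K|⁶`
  functions (indicators `[g u = v]`, `u` over the `q²+2q+2 ≤ 5q²` orbit representatives of
  `R^×` on `R²`, `v ∈ R²`) and every irreducible character inside it has degree `≤ 2|K|²`
  (constituents of `ℂ[R²]` sit in `R^×`-eigenspaces of dimension `≤ |R²/R^×|`-max-orbit-count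
  `= q² + q`).  The ring twin of the landed S2 `stub_frameStructure`.
* T2 `stub_tangentCell` (XL, the design; OPEN) — `∃ c > 0`, for unboundedly large finite fields
  `K`, SETS `X, Y, Z ⊆ GL₂(K[ε])` of sizes `≥ c|K|³`, level-one separated over the ring.
S1 `BlockContainment` is the LANDED `Theorems.GradedDesignFamily.stub_blockContainment` (p120556),
used by name.

COMPOSITION (proved, no sorry): `GradedDesignFamily_of : T1 → T2 → GradedDesignFamily` BY NAME —
bi-invariance of the ring frame space by reindexing (`frameSpace_biInv`), the budget
`Σ_{Irr ∩ F₁} d^s ≤ 5·2^s·q^{2s+2}` from S1 + T1, and the universality threshold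
`q^ε > 5(2/c)^{2+ε}`.

DISPROOF USED (`Cruxes/GradedDesignFamily/Disproof.lean`, VERDICT NO KILL, no `_false_without_`):
§1 load-bearing clauses honoured verbatim (bi-invariance PROVED for the host; both pattern halves
and strict `<` produced from T2's `if … then 1 else 0` separators); `exists_abelian_witness_iff`:
`G_q` is non-abelian (it contains `GL₂(𝔽_q)`); `no_fixed_host` / `packing_law_sharp`: honoured by
shape (`N_eff ≈ q²` and the host is chosen AFTER `ε`); `vol_le_psi`, pigeonhole
(`|X||Y| + |Y||Z| = 2c²q⁶ ≤ q⁸`), Q-filter (`n(G_q) = q − 1`, cap `≈ q^{11.5} ≫ q⁹`), abelian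
index (`a(G_q) = [G_q : Z·N] ≈ q³ ≥ c^{1/2}D^{1/4} = q^{1.5}`): all consistent with `c ≤ 1/2`.
Negatives index (4 items): none restated.  Dead lines: tiling-families (regime II) — not used.

Conventions as in the accepted skeletons of this crux: each stub statement is a plain
`def … : Prop`; the REGISTERED stubs are the sorried `theorem stub_…` in tree-only vocabulary; the
`Registered.stub_…` aliases are the hypotheses of `GradedDesignFamily_of`.
Namespace `…Cruxes.GradedDesignFamily.TangentCell`.
-/

set_option linter.dupNamespace false

noncomputable section

namespace Summit.MatrixMultiplication.MatrixMultiplication.Cruxes.GradedDesignFamily.TangentCell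

open scoped BigOperators
open Literature.RepresentationTheory.FiniteGroups
open Summit.MatrixMultiplication.MatrixMultiplication.Theses.LevelGradedCohnUmans

/-! ## Vocabulary: the level-one host `(GL₂(R), F₁(R))` over a finite commutative RING -/

section Host

variable (R : Type) [CommRing R] [Fintype R]

/-- `GL₂(R)` for a commutative ring (`R = K[ε]` is the tangent group `GL₂(K) ⋉ M₂(K)`). -/
abbrev GL2 : Type := Matrix.GeneralLinearGroup (Fin 2) R

variable {R}

/-- The level-one ("frame") test function with coefficient table `c`: `g ↦ Σ_{u ∈ R²} c u (g·u)`. -/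
def frameFn (c : (Fin 2 → R) → (Fin 2 → R) → ℂ) (g : GL2 R) : ℂ :=
  ∑ u : Fin 2 → R, c u ((g : Matrix (Fin 2) (Fin 2) R).mulVec u)

variable (R)

/-- The level-one test space `F₁(R) ≤ ℂ^{GL₂(R)}`: all frame functions (the coefficient space of
the permutation module `ℂ[R²]`). -/
def frameSpace : Submodule ℂ (GL2 R → ℂ) where
  carrier := {f | ∃ c : (Fin 2 → R) → (Fin 2 → R) → ℂ, ∀ g, f g = frameFn c g}
  add_mem' := by
    rintro f₁ f₂ ⟨c₁, h₁⟩ ⟨c₂, h₂⟩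
    refine ⟨fun u v => c₁ u v + c₂ u v, fun g => ?_⟩
    simp only [Pi.add_apply, h₁ g, h₂ g, frameFn, Finset.sum_add_distrib]
  zero_mem' := ⟨fun _ _ => 0, fun g => by simp [frameFn]⟩
  smul_mem' := by
    rintro r f ⟨c, h⟩
    refine ⟨fun u v => r * c u v, fun g => ?_⟩
    simp only [Pi.smul_apply, smul_eq_mul, h g, frameFn, Finset.mul_sum]

variable {R}

theorem frameFn_mem (c : (Fin 2 → R) → (Fin 2 → R) → ℂ) : frameFn c ∈ frameSpace R :=
  ⟨c, fun _ => rfl⟩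

/-- `u ↦ b·u` is a permutation of `R²` for `b ∈ GL₂(R)`. -/
def mulVecEquiv (b : GL2 R) : (Fin 2 → R) ≃ (Fin 2 → R) where
  toFun u := (b : Matrix (Fin 2) (Fin 2) R).mulVec u
  invFun u := ((b⁻¹ : GL2 R) : Matrix (Fin 2) (Fin 2) R).mulVec u
  left_inv u := by
    simp only [Matrix.mulVec_mulVec]
    rw [← Units.val_mul, inv_mul_cancel, Units.val_one, Matrix.one_mulVec]
  right_inv u := by
    simp only [Matrix.mulVec_mulVec]
    rw [← Units.val_mul, mul_inv_cancel, Units.val_one, Matrix.one_mulVec]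

/-- **Bi-invariance by reindexing** (any commutative ring): `g ↦ F_c(a g b)` is the frame function
of the table `(u, v) ↦ c (b⁻¹u) (a v)`. -/
theorem frameFn_transl (c : (Fin 2 → R) → (Fin 2 → R) → ℂ) (a b g : GL2 R) :
    frameFn c (a * g * b) =
      frameFn (fun u v => c (((b⁻¹ : GL2 R) : Matrix (Fin 2) (Fin 2) R).mulVec u)
        ((a : Matrix (Fin 2) (Fin 2) R).mulVec v)) g := by
  unfold frameFn
  refine Fintype.sum_equiv (mulVecEquiv b) _ _ fun u => ?_
  have hu : ((b⁻¹ : GL2 R) : Matrix (Fin 2) (Fin 2) R).mulVec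
      ((b : Matrix (Fin 2) (Fin 2) R).mulVec u) = u := (mulVecEquiv b).left_inv u
  simp only [mulVecEquiv, Equiv.coe_fn_mk, hu, Matrix.mulVec_mulVec, ← Units.val_mul, mul_assoc]

variable (R)

/-- The level-one test space over a ring is BI-INVARIANT (the crux's first clause, verbatim). -/
theorem frameSpace_biInv :
    ∀ f ∈ frameSpace R, ∀ a b : GL2 R, (fun g : GL2 R => f (a * g * b)) ∈ frameSpace R := by
  rintro f ⟨c, hc⟩ a b
  exact ⟨_, fun g => (hc (a * g * b)).trans (frameFn_transl c a b g)⟩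

variable {R}
variable [DecidableEq R]

/-- Level-one separation of a triple in `GL₂(R)` (the crux's separation clause with the test
drawn from `frameSpace R`, written with its coefficient table). -/
def FrameSeparated (X Y Z : Finset (GL2 R)) : Prop :=
  ∀ x₀ ∈ X, ∀ z₀ ∈ Z, ∃ c : (Fin 2 → R) → (Fin 2 → R) → ℂ, ∀ x ∈ X, ∀ y ∈ Y, ∀ y' ∈ Y, ∀ z ∈ Z,
    frameFn c (x⁻¹ * y * y'⁻¹ * z) = if x = x₀ ∧ y = y' ∧ z = z₀ then 1 else 0

end Host

/-! ## T1 — structure of the level-one space of the tangent group `GL₂(K[ε])` (size M) -/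

/-- **T1 `TangentStructure`.** For every finite field `K` (`q = |K|`, `R = K[ε]` the dual
numbers, `Q = |R| = q²`): (i) the frame functions on `GL₂(R)` are spanned by `≤ 5q⁶` functions
(constants and the indicators `g ↦ [g u = v]`, one `u` per orbit of `R^×` on `R²` — there are
`q² + 2q + 2 ≤ 5q²` orbits: `0`, `q+1` in `εK² ∖ 0`, `q²+q` primitive — and `v ∈ R²`), so
`dim F₁(R) ≤ 5q⁶` (truth `≈ q⁶ = Q³`); (ii) every irreducible character lying in `F₁(R)` has degree
`≤ 2q²`: `F₁(R)` is the coefficient space of `ℂ[R²] = ⊕_O ℂ[O]`, each `ℂ[O] = ⊕_θ ℂ[O]_θ` over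
characters `θ` of `R^×` (which commutes with `GL₂(R)`), `dim ℂ[O]_θ ≤ |O/R^×| ≤ q² + q`, and an
irreducible character in the coefficient space of `V` is the character of a constituent of `V`
(Schur orthogonality) — the argument of the LANDED field version `stub_frameStructure` (p120581)
with the orbit count of `K[ε]` in place of `K`.  Exact form (not needed): `Irr ∩ F₁ = {1, St_q,
(q−2) × (q+1), (q−1) × (q²−1), (q−1)² × (q²+q)}`.  Why it might fail: it does not; size M.
[cite: folklore (Clifford theory over `N = 1 + εM₂`); BlasiakCohnGrochowPrattUmans2024 §3
(frame/permutation-module form); tree `GL2PermutationCharacter`] -/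
def TangentStructure : Prop :=
  ∀ (K : Type) [Field K] [Fintype K] [DecidableEq K] [Fintype (DualNumber K)]
    [DecidableEq (DualNumber K)],
    (∃ B : Finset (GL2 (DualNumber K) → ℂ), B.card ≤ 5 * Fintype.card K ^ 6 ∧
        ∀ c : (Fin 2 → DualNumber K) → (Fin 2 → DualNumber K) → ℂ,
          frameFn c ∈ Submodule.span ℂ (B : Set (GL2 (DualNumber K) → ℂ))) ∧
    ∀ χ ∈ irrChars (GL2 (DualNumber K)),
      (∃ c : (Fin 2 → DualNumber K) → (Fin 2 → DualNumber K) → ℂ, ∀ g, χ g = frameFn c g) →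
        (χ 1).re ≤ 2 * (Fintype.card K : ℝ) ^ 2

/-- Registered stub T1 (statement = `TangentStructure`, tree-only vocabulary). -/
theorem stub_tangentStructure :
    ∀ (K : Type) [Field K] [Fintype K] [DecidableEq K] [Fintype (DualNumber K)]
      [DecidableEq (DualNumber K)],
      (∃ B : Finset (Matrix.GeneralLinearGroup (Fin 2) (DualNumber K) → ℂ),
          B.card ≤ 5 * Fintype.card K ^ 6 ∧
          ∀ c : (Fin 2 → DualNumber K) → (Fin 2 → DualNumber K) → ℂ,
            (fun g : Matrix.GeneralLinearGroup (Fin 2) (DualNumber K) =>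
                ∑ u : Fin 2 → DualNumber K,
                  c u ((g : Matrix (Fin 2) (Fin 2) (DualNumber K)).mulVec u)) ∈
              Submodule.span ℂ (B : Set (Matrix.GeneralLinearGroup (Fin 2) (DualNumber K) → ℂ))) ∧
      ∀ χ ∈ Literature.RepresentationTheory.FiniteGroups.irrChars
          (Matrix.GeneralLinearGroup (Fin 2) (DualNumber K)),
        (∃ c : (Fin 2 → DualNumber K) → (Fin 2 → DualNumber K) → ℂ,
            ∀ g : Matrix.GeneralLinearGroup (Fin 2) (DualNumber K),
              χ g = ∑ u : Fin 2 → DualNumber K,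
                c u ((g : Matrix (Fin 2) (Fin 2) (DualNumber K)).mulVec u)) →
          (χ 1).re ≤ 2 * (Fintype.card K : ℝ) ^ 2 :=
  -- LANDED (lead c7 wave 1, p171501): `Theorems/LevelGradedCohnUmansGradedDesignFamilyStubTangentStructure.lean`
  Summit.MatrixMultiplication.MatrixMultiplication.Theorems.GradedDesignFamily.stub_tangentStructure

/-! ## T2 — the tangent cell (the design; size XL, OPEN) -/

/-- **T2 `TangentCellFamily` — THE CLOSER.** There is `c > 0` such that for unboundedly large
finite fields `K` (`q = |K|`) there are SETS `X, Y, Z ⊆ GL₂(K[ε]) = GL₂(K) ⋉ M₂(K)` with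
`|X|, |Y|, |Z| ≥ c·q³` which are level-one separated over the ring `K[ε]`: for every target
`(x₀, z₀)` ONE frame function `g ↦ Σ_{u ∈ K[ε]²} c(u, g u)` reads
`[x = x₀ ∧ y = y' ∧ z = z₀]` on `x⁻¹ y y'⁻¹ z`.  The dual-number CONTRACTION of the live line's
`SubfieldCellFamily`/`LevelOneFrameFamily` (`𝔽_q[√d] ⇝ 𝔽_q[ε]`): same `Q = q²`, wall `D ≈ Q³`,
`N_eff ≈ Q`, shape `(cQ^{3/2})³`, `c ≤ 1/2` forced; ANY constant works (universality), so the
exponent-3 rung (`q = 4, 5`: `V > 1.79|G|`, `1.63|G|`) is a falsifier/confirmer, not the target.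
Sub-templates (card): outer piece `X = SL₂(K)·1` (one-subgroup identity test: `|Z|` linear
conditions; shadow = Fourier analysis on `M₂(K)` with rank-`≤1` spectrum, half-invisible
hyperplanes `{tr γA = τ}`, `γ ∈ GL₂`), Borel outer piece `X = B(K)·1` (solvable `Q(X)`, thinning
possible), mixed pieces `U ⋉ W`, `T ⋉ W`.  Why it might fail: the single-hyperplane container caps
`|Y| ≤ 5`; subgroup triples of volume `q⁹` meet along a curve (need anisotropy); a Fourier
inverse theorem for the determinantal spectrum ("a set of rank `≤ (1−c)q³` is a hyperplane up to
`(1/2−c)q³`") plus the homogeneity argument would kill the `SL₂`-outer shadow at `|Y| = O(q²)`.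
[cite: CohnUmans2003 Prop 11 (`SL₂(𝔽_q) < SL₂(𝔽_{q²})`, the un-contracted model);
BlasiakCohnGrochowPrattUmans2024 Def 2.1/Thm 2.2; BlasiakCohnGrochowPrattUmans2023 Thm 3.2
(only `n(SL₂(K[ε])) ≥ (q−1)/2` bites: det-sliced designs are dead here too)] -/
def TangentCellFamily : Prop :=
  ∃ c : ℝ, 0 < c ∧ ∀ N : ℕ, ∃ (K : Type) (_ : Field K) (_ : Fintype K) (_ : DecidableEq K)
    (_ : Fintype (DualNumber K)) (_ : DecidableEq (DualNumber K)),
    N ≤ Fintype.card K ∧ ∃ X Y Z : Finset (GL2 (DualNumber K)), FrameSeparated X Y Z ∧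
      c * (Fintype.card K : ℝ) ^ 3 ≤ X.card ∧
      c * (Fintype.card K : ℝ) ^ 3 ≤ Y.card ∧
      c * (Fintype.card K : ℝ) ^ 3 ≤ Z.card

/-- Registered stub T2 (statement = `TangentCellFamily`, tree-only vocabulary). -/
theorem stub_tangentCell :
    ∃ c : ℝ, 0 < c ∧ ∀ N : ℕ, ∃ (K : Type) (_ : Field K) (_ : Fintype K) (_ : DecidableEq K)
      (_ : Fintype (DualNumber K)) (_ : DecidableEq (DualNumber K)),
      N ≤ Fintype.card K ∧
      ∃ X Y Z : Finset (Matrix.GeneralLinearGroup (Fin 2) (DualNumber K)),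
        (∀ x₀ ∈ X, ∀ z₀ ∈ Z, ∃ c : (Fin 2 → DualNumber K) → (Fin 2 → DualNumber K) → ℂ,
          ∀ x ∈ X, ∀ y ∈ Y, ∀ y' ∈ Y, ∀ z ∈ Z,
            (∑ u : Fin 2 → DualNumber K,
                c u (((x⁻¹ * y * y'⁻¹ * z : Matrix.GeneralLinearGroup (Fin 2) (DualNumber K)) :
                  Matrix (Fin 2) (Fin 2) (DualNumber K)).mulVec u)) =
              if x = x₀ ∧ y = y' ∧ z = z₀ then 1 else 0) ∧
        c * (Fintype.card K : ℝ) ^ 3 ≤ X.card ∧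
        c * (Fintype.card K : ℝ) ^ 3 ≤ Y.card ∧
        c * (Fintype.card K : ℝ) ^ 3 ≤ Z.card := by
  sorry

/-! ### Registered-stub aliases (hypothesis heads of `GradedDesignFamily_of` are matched BY NAME) -/
namespace Registered

/-- Statement of registered stub T1. -/
abbrev stub_tangentStructure : Prop := TangentStructure
/-- Statement of registered stub T2. -/
abbrev stub_tangentCell : Prop := TangentCellFamily

end Registered

/-! ## Glue 1 (proved): the graded budget of the tangent host from S1 (landed) + T1 -/

section Budget

variable (K : Type) [Field K] [Fintype K] [DecidableEq K] [Fintype (DualNumber K)]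
  [DecidableEq (DualNumber K)]

/-- `dim F₁(K[ε]) ≤ 5 q⁶` (from T1 (i)). -/
theorem finrank_frameSpace_le (h₂ : TangentStructure) :
    (Module.finrank ℂ (frameSpace (DualNumber K)) : ℝ) ≤ 5 * (Fintype.card K : ℝ) ^ 6 := by
  obtain ⟨⟨B, hB, hspan⟩, -⟩ := h₂ K
  have hle : frameSpace (DualNumber K) ≤ Submodule.span ℂ (B : Set (GL2 (DualNumber K) → ℂ)) := by
    rintro f ⟨c, hc⟩
    have : f = frameFn c := funext hc
    rw [this]
    exact hspan c
  have h1 : Module.finrank ℂ (frameSpace (DualNumber K)) ≤ B.card :=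
    (Submodule.finrank_mono hle).trans (finrank_span_finset_le_card B)
  exact_mod_cast h1.trans hB

/-- **The level-one budget of the tangent group** (S1 landed + T1): for `s ≥ 2`,
`Σ_{χ ∈ Irr(GL₂ K[ε]) ∩ F₁} χ(1)^s ≤ (2q²)^{s−2} · 5q⁶`. -/
theorem frameBudget_le (h₂ : TangentStructure) (s : ℝ) (hs : 2 ≤ s) :
    (∑ᶠ χ ∈ irrChars (GL2 (DualNumber K)) ∩ (frameSpace (DualNumber K) : Set (GL2 (DualNumber K) → ℂ)),
        (χ 1).re ^ s) ≤
      (2 * (Fintype.card K : ℝ) ^ 2) ^ (s - 2) * (5 * (Fintype.card K : ℝ) ^ 6) := by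
  set q : ℝ := (Fintype.card K : ℝ) with hq
  have hq0 : 0 ≤ q := by positivity
  have hfin : (irrChars (GL2 (DualNumber K)) ∩
      (frameSpace (DualNumber K) : Set (GL2 (DualNumber K) → ℂ))).Finite :=
    (irrChars_finite_holds (GL2 (DualNumber K))).subset Set.inter_subset_left
  have hdeg := (h₂ K).2
  have hterm : ∀ χ ∈ hfin.toFinset,
      (χ 1).re ^ s ≤ (2 * q ^ 2) ^ (s - 2) * (χ 1).re ^ (2 : ℝ) := by
    intro χ hχ
    obtain ⟨hirr, hmem⟩ := hfin.mem_toFinset.1 hχ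
    obtain ⟨d, -, hd⟩ := IsIrrChar.exists_apply_one hirr
    have hd0 : 0 ≤ (χ 1).re := by rw [hd]; simp
    have hdQ : (χ 1).re ≤ 2 * q ^ 2 := hdeg χ hirr hmem
    have hsplit : (χ 1).re ^ s = (χ 1).re ^ (s - 2) * (χ 1).re ^ (2 : ℝ) := by
      rw [← Real.rpow_add_of_nonneg hd0 (by linarith) (by norm_num)]
      congr 1; ring
    rw [hsplit]
    exact mul_le_mul_of_nonneg_right (Real.rpow_le_rpow hd0 hdQ (by linarith))
      (Real.rpow_nonneg hd0 _)
  have hsum2 : (∑ χ ∈ hfin.toFinset, (χ 1).re ^ (2 : ℝ)) ≤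
      (Module.finrank ℂ (frameSpace (DualNumber K)) : ℝ) := by
    rw [← finsum_mem_eq_finite_toFinset_sum _ hfin]
    exact Summit.MatrixMultiplication.MatrixMultiplication.Theorems.GradedDesignFamily.stub_blockContainment
      (GL2 (DualNumber K)) (frameSpace (DualNumber K)) (frameSpace_biInv (DualNumber K))
  have h2q : 0 ≤ (2 * q ^ 2) ^ (s - 2) := Real.rpow_nonneg (by positivity) _
  calc (∑ᶠ χ ∈ irrChars (GL2 (DualNumber K)) ∩
          (frameSpace (DualNumber K) : Set (GL2 (DualNumber K) → ℂ)), (χ 1).re ^ s)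
        = ∑ χ ∈ hfin.toFinset, (χ 1).re ^ s := finsum_mem_eq_finite_toFinset_sum _ hfin
    _ ≤ ∑ χ ∈ hfin.toFinset, (2 * q ^ 2) ^ (s - 2) * (χ 1).re ^ (2 : ℝ) := Finset.sum_le_sum hterm
    _ = (2 * q ^ 2) ^ (s - 2) * ∑ χ ∈ hfin.toFinset, (χ 1).re ^ (2 : ℝ) := by rw [Finset.mul_sum]
    _ ≤ (2 * q ^ 2) ^ (s - 2) * (Module.finrank ℂ (frameSpace (DualNumber K)) : ℝ) :=
        mul_le_mul_of_nonneg_left hsum2 h2q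
    _ ≤ (2 * q ^ 2) ^ (s - 2) * (5 * q ^ 6) :=
        mul_le_mul_of_nonneg_left (finrank_frameSpace_le K h₂) h2q

/-- The budget in the shape the universality bookkeeping consumes: `≤ 5·2^s · q^{2s+2}`. -/
theorem frameBudget_le_pow (h₂ : TangentStructure) (s : ℝ) (hs : 2 ≤ s) :
    (∑ᶠ χ ∈ irrChars (GL2 (DualNumber K)) ∩ (frameSpace (DualNumber K) : Set (GL2 (DualNumber K) → ℂ)),
        (χ 1).re ^ s) ≤
      5 * (2 : ℝ) ^ s * (Fintype.card K : ℝ) ^ (2 * s + 2) := by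
  set q : ℝ := (Fintype.card K : ℝ) with hq
  have hq1 : 1 ≤ q := by rw [hq]; exact_mod_cast Fintype.card_pos
  have hq0 : 0 < q := by linarith
  refine (frameBudget_le K h₂ s hs).trans ?_
  -- (2q²)^(s-2) · 5q⁶ = 5 · 2^(s-2) · q^(2s+2) ≤ 5 · 2^s · q^(2s+2)
  have h1 : (2 * q ^ 2) ^ (s - 2) = (2 : ℝ) ^ (s - 2) * q ^ (2 * s - 4) := by
    rw [Real.mul_rpow (by norm_num) (by positivity)]
    congr 1
    rw [show (q ^ 2 : ℝ) = q ^ (2 : ℝ) by norm_cast, ← Real.rpow_mul hq0.le]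
    congr 1; ring
  have h2 : q ^ (2 * s - 4) * q ^ 6 = q ^ (2 * s + 2) := by
    rw [show (q ^ 6 : ℝ) = q ^ (6 : ℝ) by norm_cast, ← Real.rpow_add hq0]
    congr 1; ring
  have h3 : (2 : ℝ) ^ (s - 2) ≤ (2 : ℝ) ^ s :=
    Real.rpow_le_rpow_of_exponent_le (by norm_num) (by linarith)
  calc (2 * q ^ 2) ^ (s - 2) * (5 * q ^ 6)
        = 5 * (2 : ℝ) ^ (s - 2) * (q ^ (2 * s - 4) * q ^ 6) := by rw [h1]; ring
    _ = 5 * (2 : ℝ) ^ (s - 2) * q ^ (2 * s + 2) := by rw [h2]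
    _ ≤ 5 * (2 : ℝ) ^ s * q ^ (2 * s + 2) := by
        have : 0 ≤ q ^ (2 * s + 2) := Real.rpow_nonneg hq0.le _
        gcongr

end Budget

/-! ## Glue 2 (proved): universality of the tangent cell — S1 + T1 + T2 ⇒ the crux -/

/-- **Universality of the tangent cell**: the host `(GL₂(K[ε]), F₁(K[ε]))` is bi-invariant, the
frame separators are `F₁`-separators verbatim, and the budget `≤ 5·2^{2+ε} q^{6+2ε}` loses to
`V^{(2+ε)/3} ≥ c^{2+ε} q^{6+3ε}` once `q^ε > 5 (2/c)^{2+ε}` — `N_eff ≈ q²` comparable blocks at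
the FIXED cell. -/
theorem cruxBody_of_tangentFamily (h₂ : TangentStructure) (hdesign : TangentCellFamily) :
    ∀ ε : ℝ, 0 < ε → ∃ (G : Type) (_ : Group G) (_ : Fintype G) (J : Submodule ℂ (G → ℂ))
      (X Y Z : Finset G), (∀ f ∈ J, ∀ a b : G, (fun g : G => f (a * g * b)) ∈ J) ∧
      (∀ x₀ ∈ X, ∀ z₀ ∈ Z, ∃ f ∈ J, ∀ x ∈ X, ∀ y ∈ Y, ∀ y' ∈ Y, ∀ z ∈ Z,
        (x = x₀ ∧ y = y' ∧ z = z₀ → f (x⁻¹ * y * y'⁻¹ * z) = 1) ∧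
        (¬ (x = x₀ ∧ y = y' ∧ z = z₀) → f (x⁻¹ * y * y'⁻¹ * z) = 0)) ∧
      (∑ᶠ χ ∈ Literature.RepresentationTheory.FiniteGroups.irrChars G ∩ (J : Set (G → ℂ)),
        (χ 1).re ^ (2 + ε)) < ((X.card * Y.card * Z.card : ℕ) : ℝ) ^ ((2 + ε) / 3) := by
  intro ε hε
  obtain ⟨c, hc, hall⟩ := hdesign
  set s : ℝ := 2 + ε with hs_def
  have hs : 0 < s := by rw [hs_def]; linarith
  have hs2 : 2 ≤ s := by rw [hs_def]; linarith
  set L : ℝ := 5 * (2 / c) ^ s with hL_def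
  have hL : 0 ≤ L := by rw [hL_def]; positivity
  obtain ⟨N, hN⟩ := exists_nat_gt (max 1 (L ^ (1 / ε)))
  obtain ⟨K, instF, instFt, instD, instFt2, instD2, hNK, X, Y, Z, hsep, hX, hY, hZ⟩ := hall N
  set q : ℝ := (Fintype.card K : ℝ) with hq_def
  have hNR : (N : ℝ) ≤ q := by rw [hq_def]; exact_mod_cast hNK
  have hq1 : (1 : ℝ) < q := lt_of_lt_of_le (lt_of_le_of_lt (le_max_left _ _) hN) hNR
  have hqL : L ^ (1 / ε) < q := lt_of_lt_of_le (lt_of_le_of_lt (le_max_right _ _) hN) hNR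
  have hq0 : (0 : ℝ) < q := by linarith
  -- the key threshold: L < q ^ ε
  have hLq : L < q ^ ε := by
    have h1 : (L ^ (1 / ε)) ^ ε < q ^ ε :=
      Real.rpow_lt_rpow (by positivity) hqL hε
    have h2 : (L ^ (1 / ε)) ^ ε = L := by
      rw [← Real.rpow_mul hL]
      have : (1 / ε) * ε = 1 := by field_simp
      rw [this, Real.rpow_one]
    rwa [h2] at h1
  refine ⟨GL2 (DualNumber K), inferInstance, inferInstance, frameSpace (DualNumber K), X, Y, Z,
    frameSpace_biInv (DualNumber K), ?_, ?_⟩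
  · -- separation: frame separators are `F₁`-separators verbatim
    intro x₀ hx₀ z₀ hz₀
    obtain ⟨cf, hcf⟩ := hsep x₀ hx₀ z₀ hz₀
    refine ⟨frameFn cf, frameFn_mem cf, fun x hx y hy y' hy' z hz => ⟨fun h => ?_, fun h => ?_⟩⟩
    · exact (hcf x hx y hy y' hy' z hz).trans (if_pos h)
    · exact (hcf x hx y hy y' hy' z hz).trans (if_neg h)
  · -- budget < volume^{s/3}
    have hB := frameBudget_le_pow K h₂ s hs2
    change (∑ᶠ χ ∈ irrChars (GL2 (DualNumber K)) ∩
        (frameSpace (DualNumber K) : Set (GL2 (DualNumber K) → ℂ)), (χ 1).re ^ s) <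
      ((X.card * Y.card * Z.card : ℕ) : ℝ) ^ (s / 3)
    have hc3 : 0 < c * q ^ 3 := by positivity
    have hXpos : (0 : ℝ) < X.card := lt_of_lt_of_le hc3 hX
    have hYpos : (0 : ℝ) < Y.card := lt_of_lt_of_le hc3 hY
    have hZpos : (0 : ℝ) < Z.card := lt_of_lt_of_le hc3 hZ
    have hV : (c * q ^ 3) ^ (3 : ℕ) ≤ ((X.card * Y.card * Z.card : ℕ) : ℝ) := by
      push_cast
      have := mul_le_mul (mul_le_mul hX hY hc3.le hXpos.le) hZ hc3.le (by positivity)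
      nlinarith [this]
    have hV' : ((c * q ^ 3) ^ (3 : ℕ)) ^ (s / 3) ≤
        ((X.card * Y.card * Z.card : ℕ) : ℝ) ^ (s / 3) :=
      Real.rpow_le_rpow (by positivity) hV (by positivity)
    have hV'' : ((c * q ^ 3) ^ (3 : ℕ)) ^ (s / 3) = c ^ s * (q ^ (2 * s + 2) * q ^ ε) := by
      rw [← Real.rpow_natCast, ← Real.rpow_mul hc3.le]
      have h3 : ((3 : ℕ) : ℝ) * (s / 3) = s := by push_cast; ring
      rw [h3, Real.mul_rpow hc.le (by positivity)]
      congr 1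
      rw [show (q ^ 3 : ℝ) = q ^ (3 : ℝ) by norm_cast, ← Real.rpow_mul hq0.le,
        ← Real.rpow_add hq0]
      congr 1
      rw [hs_def]; ring
    have hfinal : 5 * (2 : ℝ) ^ s * q ^ (2 * s + 2) < c ^ s * (q ^ (2 * s + 2) * q ^ ε) := by
      have hcs : 0 < c ^ s := Real.rpow_pos_of_pos hc s
      have hq2s : 0 < q ^ (2 * s + 2) := Real.rpow_pos_of_pos hq0 _
      have hLc : c ^ s * L = 5 * (2 : ℝ) ^ s := by
        rw [hL_def, Real.div_rpow (by norm_num) hc.le]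
        field_simp
      calc 5 * (2 : ℝ) ^ s * q ^ (2 * s + 2) = c ^ s * (q ^ (2 * s + 2) * L) := by
            rw [← hLc]; ring
        _ < c ^ s * (q ^ (2 * s + 2) * q ^ ε) := by gcongr
    calc (∑ᶠ χ ∈ irrChars (GL2 (DualNumber K)) ∩
            (frameSpace (DualNumber K) : Set (GL2 (DualNumber K) → ℂ)), (χ 1).re ^ s)
          ≤ 5 * (2 : ℝ) ^ s * q ^ (2 * s + 2) := hB
      _ < c ^ s * (q ^ (2 * s + 2) * q ^ ε) := hfinal
      _ = ((c * q ^ 3) ^ (3 : ℕ)) ^ (s / 3) := hV''.symm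
      _ ≤ ((X.card * Y.card * Z.card : ℕ) : ℝ) ^ (s / 3) := hV'

/-! ## The composition (proved): T1 → T2 → crux, BY NAME -/

/-- **The skeleton closes the crux modulo the registered stubs**: S1 (landed) + T1 price the
level-one host of the tangent group; T2 supplies the designs; universality turns constant-factor
wall saturation at the fixed cell into every `ε`. -/
theorem GradedDesignFamily_of (h₁ : Registered.stub_tangentStructure)
    (h₂ : Registered.stub_tangentCell) :
    Summit.MatrixMultiplication.MatrixMultiplication.Theses.LevelGradedCohnUmans.GradedDesignFamily :=
  cruxBody_of_tangentFamily h₁ h₂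

/-- The tree-only spellings of the registered stubs are definitionally the named statements. -/
example : Summit.MatrixMultiplication.MatrixMultiplication.Theses.LevelGradedCohnUmans.GradedDesignFamily :=
  GradedDesignFamily_of stub_tangentStructure stub_tangentCell

end Summit.MatrixMultiplication.MatrixMultiplication.Cruxes.GradedDesignFamily.TangentCell

end
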